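import Summits.PneNP.PneNP.Theorems.CodingVolumeShiftsCodingVolumeRungs
import Summits.PneNP.PneNP.Theorems.CodingVolumeShiftsCodingVolumeGraded

/-!
# Route CodingVolumeShifts — crux `CodingVolume` (stmt-PneNP-19454): meager cuts, and the
# cross-far regime

Two more pieces of the volume ladder X = `CodingVolume`
(`∀ Δ C, ∃ L, ∀ N, N.DegLE Δ → N.Far L → Nonempty N.Code → C·k ≤ m`).

* `codingVolume_meager_bound` — the MEAGERNESS bound of a binary one-shot code, with the other
  inputs hard-wired: if `J` is a set of commodities and `E` a set of arcs such that every directed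
  path from a source of `J` to a sink of `J` uses an arc of `E`, then `|J| ≤ |E|`. Paths are not
  spelled out: the hypothesis is a vertex predicate `Q` ("can still reach a sink of `J` avoiding `E`")
  containing the sinks of `J`, avoiding the sources of `J`, and closed BACKWARDS along every arc that
  is neither in `E` nor leaves a source outside `J` (such arcs carry constants once the other inputs
  are fixed). Injectivity `Bool^J ↪ Bool^E` by rank induction on `local_`. It subsumes the cut-set
  bound `codingVolume_cut_bound` (`Q = (· ∈ U)`, `E` = arcs entering `U`) and refines it:
  `codingVolume_cut_bound_refined` — arcs entering `U` out of sources whose own sink is not cut off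
  by `U` need not be counted.
* `codingVolume_crossFar_arcs` — the CROSS-FAR regime: if EVERY source is at undirected distance
  `≥ L` from EVERY sink (not only from its own), a coded network has `L·k ≤ m`, with no degree bound:
  the `L` vertex sets `{v | L' ≤ d(s, v) for all sources s}` (`1 ≤ L' ≤ L`) each cut all `k`
  commodities off, and an arc enters at most one of them. Crux-shaped: `codingVolume_crossFar`
  (every cell `(Δ, C)` with `L = C`, under the extra hypothesis that distinct commodities' sources
  and sinks are `L`-far too).

Reading. Together with the graded regime (`CodingVolumeShiftsCodingVolumeGraded`) this localises the
content of X: a counterexample needs, at every scale, sinks close to OTHER commodities' sources (side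
information geometry) and level-skipping arcs. No definitions; route-independent (imports the Rungs
and Graded files, no Theses file). Appended: the NEAREST-TERMINAL volume laws
`codingVolume_sum_sourceDist_le_arcCount` / `codingVolume_sum_sinkDist_le_arcCount`
(`Σ_i d(S, sink i) ≤ m` and `Σ_i d(source i, T) ≤ m`, hypothesis-free).
-/

set_option linter.dupNamespace false -- `Summit.PneNP.PneNP.…`: summit = sub-problem name (D-0017)

namespace Summit.PneNP.PneNP.Theorems

open Literature.InformationTheory.NetworkCoding Finset

section Meager

variable {ι : Type} {N : KPairsNet ι}

/-- **MEAGERNESS BOUND (other inputs hard-wired).** Let `J` be a set of commodities, `E` a set of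
arcs and `Q` a vertex predicate such that: every sink of `J` satisfies `Q`; no source of `J` does;
and `Q` is closed backwards along every arc not in `E` whose tail is not a source outside `J`
(so `Q v` may be read "from `v` some sink of `J` is reachable along arcs avoiding `E`"; arcs out of
foreign sources carry constants once the inputs outside `J` are fixed to `false`). Then a binary
one-shot code forces `|J| ≤ |E|`: the bits on `E` determine every bit entering a `Q`-vertex (rank
induction on locality), hence the commodities `J` (decodability) — an injection `Bool^J ↪ Bool^E`.
This is the meagerness bound of network coding on the directed network, in integral one-bit form.
[folklore] -/
theorem codingVolume_meager_bound [Fintype ι] (c : N.Code) (J : Finset ι) (E : Finset N.A)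
    (Q : N.V → Prop) (hsink : ∀ j ∈ J, Q (N.sink j)) (hsource : ∀ j ∈ J, ¬ Q (N.source j))
    (hback : ∀ a, Q (N.tgt a) → a ∉ E → (∀ l, l ∉ J → N.src a ≠ N.source l) → Q (N.src a)) :
    J.card ≤ E.card := by
  classical
  -- inputs supported on `J`
  let ext : ({i // i ∈ J} → Bool) → (ι → Bool) := fun y j => if h : j ∈ J then y ⟨j, h⟩ else false
  let φ : ({i // i ∈ J} → Bool) → ({a // a ∈ E} → Bool) := fun y a => c.val a.1 (ext y)
  have hφ : Function.Injective φ := by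
    intro y y' h
    -- every arc whose head satisfies `Q` carries the same bit on `ext y` and `ext y'`
    have hagree : ∀ a, Q (N.tgt a) → c.val a (ext y) = c.val a (ext y') := by
      suffices hh : ∀ (r : ℕ) (a : N.A), N.rank (N.src a) = r → Q (N.tgt a) →
          c.val a (ext y) = c.val a (ext y') from fun a => hh _ a rfl
      intro r
      induction r using Nat.strong_induction_on with
      | _ r ih =>
        intro a hr hQa
        by_cases haE : a ∈ E
        · exact congrFun h ⟨a, haE⟩
        by_cases hfor : ∃ l, l ∉ J ∧ N.src a = N.source l
        · -- `a` leaves a foreign source: its bit is a function of a hard-wired input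
          obtain ⟨l, hlJ, hl⟩ := hfor
          refine c.local_ a _ _ (fun b hb => absurd (hb.trans hl) (N.source_in b l)) ?_
          intro l' hl'
          have hll : l' = l := N.source.injective (hl'.trans hl)
          subst hll
          simp [ext, hlJ]
        · push Not at hfor
          have hQs : Q (N.src a) := hback a hQa haE (fun l hl hls => hfor l hl hls)
          refine c.local_ a _ _ (fun b hb => ih _ ?_ b rfl (by rw [hb]; exact hQs)) ?_
          · rw [← hr, ← hb]; exact N.rank_lt b
          · -- the tail of `a` is no source: a source of `J` never satisfies `Q`,
            -- a foreign one is excluded in this branch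
            intro l hl
            exfalso
            by_cases hlJ : l ∈ J
            · exact hsource l hlJ (hl ▸ hQs)
            · exact hfor l hlJ hl.symm
    funext ⟨j, hj⟩
    have key := c.decode j (ext y) (ext y') (fun b hb => hagree b (by rw [hb]; exact hsink j hj))
    simpa [ext, hj] using key
  have h2 : 2 ^ J.card ≤ 2 ^ E.card := by
    simpa [Fintype.card_fun, Fintype.card_bool, Fintype.card_coe] using
      Fintype.card_le_of_injective φ hφ
  exact (Nat.pow_le_pow_iff_right (by norm_num)).1 h2

/-- **Refined cut-set bound.** For a vertex set `U`, let `J` be the commodities whose sink lies in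
`U` and whose source does not. Then `|J|` is at most the number of arcs entering `U` whose tail is
NOT a source outside `J` (arcs out of a source whose own sink is outside `U`, or which sits in `U`,
are free: with the inputs outside `J` hard-wired they carry constants). Sharpens
`codingVolume_cut_bound`. [folklore] -/
theorem codingVolume_cut_bound_refined [Fintype ι] (c : N.Code) (U : Finset N.V) :
    (univ.filter fun i => N.sink i ∈ U ∧ N.source i ∉ U).card ≤
      (univ.filter fun a => N.src a ∉ U ∧ N.tgt a ∈ U ∧
        ∀ l, N.src a = N.source l → N.sink l ∈ U).card := by
  classical
  refine codingVolume_meager_bound c _ _ (fun v => v ∈ U) (fun j hj => (mem_filter.mp hj).2.1)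
    (fun j hj => (mem_filter.mp hj).2.2) (fun a hQa haE hfor => ?_)
  by_contra hsrc
  apply haE
  rw [mem_filter]
  refine ⟨mem_univ _, hsrc, hQa, fun l hl => ?_⟩
  by_contra hsl
  refine hfor l ?_ hl
  rw [mem_filter]
  exact fun h => hsl h.2.1

end Meager

section CrossFar

variable {ι : Type} {N : KPairsNet ι}

/-- One undirected step changes the distance from a fixed vertex by at most one (arc form): for
every arc `a` and vertex `s`, `edist s (tgt a) ≤ edist s (src a) + 1`. [folklore] -/
theorem codingVolume_edist_tgt_le_src_add_one (a : N.A) (s : N.V) :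
    N.graph.edist s (N.tgt a) ≤ N.graph.edist s (N.src a) + 1 := by
  calc N.graph.edist s (N.tgt a)
      ≤ N.graph.edist s (N.src a) + N.graph.edist (N.src a) (N.tgt a) :=
        SimpleGraph.edist_triangle
    _ = N.graph.edist s (N.src a) + 1 := by
        rw [SimpleGraph.edist_eq_one_iff_adj.mpr (codingVolume_adj_arc a)]

/-- **CROSS-FAR REGIME (arc form): `L·k ≤ m`.** If every source is at undirected distance `≥ L`
from every sink (its own and the other commodities'), a k-pairs network with a binary one-shot code
has at least `L·k` arcs, with no degree bound: for `1 ≤ L' ≤ L` the set of vertices at distance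
`≥ L'` from all sources contains every sink and no source, so (`codingVolume_cut_bound`) at least `k`
arcs enter it, and these entering arcs go from distance exactly `L' − 1` to distance `L'`, hence are
distinct for distinct `L'`. [folklore] -/
theorem codingVolume_crossFar_arcs [Fintype ι] (N : KPairsNet ι) {L : ℕ}
    (hcross : ∀ i j, (L : ℕ∞) ≤ N.graph.edist (N.source i) (N.sink j)) (c : N.Code) :
    L * Fintype.card ι ≤ N.arcCount := by
  classical
  -- the layer sets and their entering arcs
  let U : ℕ → Finset N.V := fun r =>
    univ.filter fun v => ∀ j, (r : ℕ∞) ≤ N.graph.edist (N.source j) v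
  let In : ℕ → Finset N.A := fun r => univ.filter fun a => N.src a ∉ U r ∧ N.tgt a ∈ U r
  -- each layer cuts off all commodities
  have hk : ∀ r, 1 ≤ r → r ≤ L → Fintype.card ι ≤ (In r).card := by
    intro r hr1 hrL
    have h := codingVolume_cut_bound c (U r)
    refine le_trans (le_of_eq ?_) h
    rw [← Finset.card_univ]
    congr 1
    ext i
    simp only [Finset.mem_filter, Finset.mem_univ, true_and, U]
    refine ⟨fun hi => ⟨fun j => le_trans (by exact_mod_cast hrL) (hcross j i), fun h => ?_⟩,
      fun _ => trivial⟩
    have h0 := h i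
    rw [SimpleGraph.edist_self] at h0
    have : (r : ℕ∞) = 0 := le_antisymm h0 bot_le
    have : r = 0 := by exact_mod_cast this
    omega
  -- an arc enters at most one layer
  have hdisj : (↑(Finset.Icc 1 L) : Set ℕ).PairwiseDisjoint In := by
    intro r _ r' _ hrr
    rw [Function.onFun, Finset.disjoint_left]
    intro a ha ha'
    simp only [Finset.mem_filter, Finset.mem_univ, true_and, In, U, not_forall, not_le] at ha ha'
    obtain ⟨⟨j, hj⟩, ht⟩ := ha
    obtain ⟨⟨j', hj'⟩, ht'⟩ := ha'
    apply hrr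
    -- `r ≤ edist (source j') (tgt a) ≤ edist (source j') (src a) + 1 < r' + 1`, and symmetrically
    have h1 := (ht j').trans (codingVolume_edist_tgt_le_src_add_one a (N.source j'))
    have h2 := (ht' j).trans (codingVolume_edist_tgt_le_src_add_one a (N.source j))
    -- pass to `ℕ` through the finite distances
    obtain ⟨n, hn⟩ := ENat.ne_top_iff_exists.mp (hj.trans_le le_top).ne
    obtain ⟨n', hn'⟩ := ENat.ne_top_iff_exists.mp (hj'.trans_le le_top).ne
    rw [← hn] at hj h2
    rw [← hn'] at hj' h1
    have e1 : r ≤ n' + 1 := by exact_mod_cast h1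
    have e2 : r' ≤ n + 1 := by exact_mod_cast h2
    have e3 : n < r := by exact_mod_cast hj
    have e4 : n' < r' := by exact_mod_cast hj'
    omega
  calc L * Fintype.card ι = ∑ _r ∈ Finset.Icc 1 L, Fintype.card ι := by simp
    _ ≤ ∑ r ∈ Finset.Icc 1 L, (In r).card :=
        Finset.sum_le_sum fun r hr => hk r (Finset.mem_Icc.mp hr).1 (Finset.mem_Icc.mp hr).2
    _ = ((Finset.Icc 1 L).biUnion In).card := (Finset.card_biUnion hdisj).symm
    _ ≤ Fintype.card N.A := Finset.card_le_univ _
    _ = N.arcCount := rfl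

/-- **`CodingVolume` in the cross-far regime, in the shape of the crux (stmt-PneNP-19454):** for all
`Δ, C`, with `L := C`, every k-pairs DAG carrying a binary one-shot code in which, besides each pair
being `L`-far (`N.Far L`), every source is `L`-far from every OTHER commodity's sink, has
`C·k ≤ m` — all cells, optimal `L`, degree bound unused. What X adds to this is exactly the regime of
sinks lying close to foreign sources (side information). [folklore] -/
theorem codingVolume_crossFar : ∀ Δ C : ℕ, ∃ L : ℕ, ∀ (ι : Type) [Fintype ι] (N : KPairsNet ι),
    (∀ i j, i ≠ j → (L : ℕ∞) ≤ N.graph.edist (N.source i) (N.sink j)) →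
    N.DegLE Δ → N.Far L → Nonempty N.Code → C * Fintype.card ι ≤ N.arcCount := by
  intro _ C
  refine ⟨C, fun ι _ N hcross _ hfar hc => hc.elim fun c => codingVolume_crossFar_arcs N ?_ c⟩
  intro i j
  by_cases hij : i = j
  · subst hij; exact hfar i
  · exact hcross i j hij

end CrossFar

/-! ### Nearest-terminal volume laws (appended)

Hypothesis-free sharpenings of the cross-far rung: a coded k-pairs network has at least
`Σ_i d(S, sink i)` arcs and at least `Σ_i d(source i, T)` arcs, where `d(S, ·)` is the undirected
distance from the SET of all sources and `d(·, T)` the distance to the set of all sinks (stated with a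
certified lower bound `d i` per commodity, to stay in `ℕ`). So every sink pays its distance to the
NEAREST source, own or foreign: what the `Far L` hypothesis of X fails to control is precisely
`d(S, sink i) < L`, a foreign source near the sink. -/

section Nearest

variable {ι : Type} {N : KPairsNet ι}

/-- One undirected step changes the distance to a fixed vertex by at most one (arc form, reversed):
`edist (src a) t ≤ edist (tgt a) t + 1`. [folklore] -/
theorem codingVolume_edist_src_le_tgt_add_one (a : N.A) (t : N.V) :
    N.graph.edist (N.src a) t ≤ N.graph.edist (N.tgt a) t + 1 := by
  calc N.graph.edist (N.src a) t
      ≤ N.graph.edist (N.src a) (N.tgt a) + N.graph.edist (N.tgt a) t :=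
        SimpleGraph.edist_triangle
    _ = N.graph.edist (N.tgt a) t + 1 := by
        rw [SimpleGraph.edist_eq_one_iff_adj.mpr (codingVolume_adj_arc a), add_comm]

/-- **NEAREST-SOURCE VOLUME LAW: `Σ_i d(S, sink i) ≤ m`.** If sink `i` is at undirected distance
`≥ d i` from EVERY source (`d(S, sink i) ≥ d i`), then a binary one-shot code forces `Σ_i d i ≤ m`,
with no `Far` and no degree hypothesis: for each `r ≥ 1` the vertices at distance `≥ r` from all
sources form a set entered by at least `#{i | r ≤ d i}` arcs (`codingVolume_cut_bound`), and an arc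
enters the `r`-th set only if its tail is at distance exactly `r − 1` from the sources, so these
arc sets are disjoint. (`codingVolume_crossFar_arcs` is the case `d i = L`.) [folklore] -/
theorem codingVolume_sum_sourceDist_le_arcCount [Fintype ι] (N : KPairsNet ι) (c : N.Code)
    (d : ι → ℕ) (hd : ∀ i j, (d i : ℕ∞) ≤ N.graph.edist (N.source j) (N.sink i)) :
    ∑ i, d i ≤ N.arcCount := by
  classical
  let U : ℕ → Finset N.V := fun r =>
    univ.filter fun v => ∀ j, (r : ℕ∞) ≤ N.graph.edist (N.source j) v
  let In : ℕ → Finset N.A := fun r => univ.filter fun a => N.src a ∉ U r ∧ N.tgt a ∈ U r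
  set D : ℕ := univ.sup d + 1 with hD
  have hltD : ∀ i, d i < D := fun i => Nat.lt_succ_of_le (Finset.le_sup (f := d) (mem_univ i))
  -- layer `r` cuts off every commodity with `r ≤ d i`
  have hk : ∀ r, (univ.filter fun i => 0 < r ∧ r ≤ d i).card ≤ (In r).card := by
    intro r
    refine le_trans (Finset.card_le_card fun i hi => ?_) (codingVolume_cut_bound c (U r))
    rw [mem_filter] at hi ⊢
    refine ⟨mem_univ _, ?_, fun h => ?_⟩
    · rw [mem_filter]
      exact ⟨mem_univ _, fun j => le_trans (by exact_mod_cast hi.2.2) (hd i j)⟩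
    · rw [mem_filter] at h
      have h0 := h.2 i
      rw [SimpleGraph.edist_self] at h0
      have : (r : ℕ∞) = 0 := le_antisymm h0 bot_le
      have : r = 0 := by exact_mod_cast this
      omega
  -- an arc enters at most one layer
  have hdisj : (↑(Finset.range D) : Set ℕ).PairwiseDisjoint In := by
    intro r _ r' _ hrr
    rw [Function.onFun, Finset.disjoint_left]
    intro a ha ha'
    simp only [Finset.mem_filter, Finset.mem_univ, true_and, In, U, not_forall, not_le] at ha ha'
    obtain ⟨⟨j, hj⟩, ht⟩ := ha
    obtain ⟨⟨j', hj'⟩, ht'⟩ := ha'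
    apply hrr
    have h1 := (ht j').trans (codingVolume_edist_tgt_le_src_add_one a (N.source j'))
    have h2 := (ht' j).trans (codingVolume_edist_tgt_le_src_add_one a (N.source j))
    obtain ⟨n, hn⟩ := ENat.ne_top_iff_exists.mp (hj.trans_le le_top).ne
    obtain ⟨n', hn'⟩ := ENat.ne_top_iff_exists.mp (hj'.trans_le le_top).ne
    rw [← hn] at hj h2
    rw [← hn'] at hj' h1
    have e1 : r ≤ n' + 1 := by exact_mod_cast h1
    have e2 : r' ≤ n + 1 := by exact_mod_cast h2
    have e3 : n < r := by exact_mod_cast hj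
    have e4 : n' < r' := by exact_mod_cast hj'
    omega
  calc ∑ i, d i = ∑ i, (d i - 0) := by simp
    _ = ∑ r ∈ Finset.range D, (univ.filter fun i => 0 < r ∧ r ≤ d i).card :=
        (codingVolume_sum_card_filter_Ioc (fun _ => 0) d D hltD).symm
    _ ≤ ∑ r ∈ Finset.range D, (In r).card := Finset.sum_le_sum fun r _ => hk r
    _ = ((Finset.range D).biUnion In).card := (Finset.card_biUnion hdisj).symm
    _ ≤ Fintype.card N.A := Finset.card_le_univ _
    _ = N.arcCount := rfl

/-- **NEAREST-SINK VOLUME LAW: `Σ_i d(source i, T) ≤ m`.** Symmetrically, if source `i` is at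
undirected distance `≥ d i` from EVERY sink, then a binary one-shot code forces `Σ_i d i ≤ m`: for
each `r ≥ 1` the vertices within distance `< r` of some sink form a set containing all sinks and no
source `i` with `r ≤ d i`, entered by at least that many arcs (`codingVolume_cut_bound`); an arc
enters the `r`-th set only if its head is at distance exactly `r − 1` from the sinks. [folklore] -/
theorem codingVolume_sum_sinkDist_le_arcCount [Fintype ι] (N : KPairsNet ι) (c : N.Code)
    (d : ι → ℕ) (hd : ∀ i j, (d i : ℕ∞) ≤ N.graph.edist (N.source i) (N.sink j)) :
    ∑ i, d i ≤ N.arcCount := by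
  classical
  let U : ℕ → Finset N.V := fun r =>
    univ.filter fun v => ∃ j, N.graph.edist v (N.sink j) < (r : ℕ∞)
  let In : ℕ → Finset N.A := fun r => univ.filter fun a => N.src a ∉ U r ∧ N.tgt a ∈ U r
  set D : ℕ := univ.sup d + 1 with hD
  have hltD : ∀ i, d i < D := fun i => Nat.lt_succ_of_le (Finset.le_sup (f := d) (mem_univ i))
  -- layer `r` cuts off every commodity with `1 ≤ r ≤ d i`
  have hk : ∀ r, (univ.filter fun i => 0 < r ∧ r ≤ d i).card ≤ (In r).card := by
    intro r
    refine le_trans (Finset.card_le_card fun i hi => ?_) (codingVolume_cut_bound c (U r))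
    rw [mem_filter] at hi ⊢
    refine ⟨mem_univ _, ?_, fun h => ?_⟩
    · rw [mem_filter]
      refine ⟨mem_univ _, i, ?_⟩
      rw [SimpleGraph.edist_self]
      exact_mod_cast hi.2.1
    · rw [mem_filter] at h
      obtain ⟨j, hj⟩ := h.2
      exact absurd (lt_of_lt_of_le hj (le_trans (by exact_mod_cast hi.2.2) (hd i j))) (lt_irrefl _)
  -- an arc enters at most one layer
  have hdisj : (↑(Finset.range D) : Set ℕ).PairwiseDisjoint In := by
    intro r _ r' _ hrr
    rw [Function.onFun, Finset.disjoint_left]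
    intro a ha ha'
    simp only [Finset.mem_filter, Finset.mem_univ, true_and, In, U, not_exists, not_lt] at ha ha'
    obtain ⟨hs, j, hj⟩ := ha
    obtain ⟨hs', j', hj'⟩ := ha'
    apply hrr
    have h1 := (hs' j).trans (codingVolume_edist_src_le_tgt_add_one a (N.sink j))
    have h2 := (hs j').trans (codingVolume_edist_src_le_tgt_add_one a (N.sink j'))
    obtain ⟨n, hn⟩ := ENat.ne_top_iff_exists.mp (hj.trans_le le_top).ne
    obtain ⟨n', hn'⟩ := ENat.ne_top_iff_exists.mp (hj'.trans_le le_top).ne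
    rw [← hn] at hj h1
    rw [← hn'] at hj' h2
    have e1 : r' ≤ n + 1 := by exact_mod_cast h1
    have e2 : r ≤ n' + 1 := by exact_mod_cast h2
    have e3 : n < r := by exact_mod_cast hj
    have e4 : n' < r' := by exact_mod_cast hj'
    omega
  calc ∑ i, d i = ∑ i, (d i - 0) := by simp
    _ = ∑ r ∈ Finset.range D, (univ.filter fun i => 0 < r ∧ r ≤ d i).card :=
        (codingVolume_sum_card_filter_Ioc (fun _ => 0) d D hltD).symm
    _ ≤ ∑ r ∈ Finset.range D, (In r).card := Finset.sum_le_sum fun r _ => hk r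
    _ = ((Finset.range D).biUnion In).card := (Finset.card_biUnion hdisj).symm
    _ ≤ Fintype.card N.A := Finset.card_le_univ _
    _ = N.arcCount := rfl

end Nearest

end Summit.PneNP.PneNP.Theorems
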